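import Summits.Schanuel.Schanuel.Theorems.SoloInformedX193TwistPiece
import Summits.Schanuel.Schanuel.Theorems.SoloInformedX193Budget
import Summits.Schanuel.Schanuel.Theorems.SoloInformedX193Resultant

/-!
# X193 kernel, file F11a-2 — the twist law (TW) for `soloX_pieces`

Solo-informed Schanuel programme (toy line X), kernel of Roy's small value programme
[Roy2010, Thm 2.6 (i)]: the concrete service data `soloX_pieces ξ R`
(`SoloInformedX193Pieces`) satisfies the twist law `SoloServiceData.twistLaw`
(`SoloInformedX193Service`) when `ξ` is transcendental:

  `soloX_pieces_twistLaw : Transcendental ℚ ξ → soloX_pieces ξ R ∈ twistLaw`.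

For a piece `P` and `k, j ≥ 1` the twist `twist P k j` IS the twist polynomial
(`soloX_pieces_twist_val'`, by `soloX_twistPoly_mem` of file F11a-1), and over `ℚ` it is a
unit multiple of `P(kT/j)` (`soloX_pieces_twist_map_associated`).  The six conjuncts:

* (TW1) `twist P k k = P`, (TW2) `twist (twist P k j) j j' = twist P k j'`: both sides are
  pieces associated over `ℚ` to the same `P(cT)`, hence equal
  (`soloX_piece_eq_of_associated_map`);
* (TW3) `j ≠ j' → twist P k j ≠ twist P k j'`: `P(kT/j)` and `P(kT/j')` are unit multiples of
  each other only if `(k/j)^g = (k/j')^g` (compare constant and leading coefficients; a piece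
  has `a_0 a_g ≠ 0`);
* (TW4) `deg (twist P k j) = deg P`;
* (TW5) `logHt (twist P k j) ≤ logHt P + deg P · log max(k, j)` from
  `‖primPart (dil P k j)‖_∞ ≤ ‖dil P k j‖_∞ ≤ max(k, j)^g ‖P‖_∞`;
* (TW6) `bank P k - deg P · log max(k, j) ≤ bank (twist P k j) j` from
  `|twist P k j (jξ)| ≤ |dil P k j (jξ)| = j^g |P(kξ)|` (transcendence of `ξ` keeps both
  values non-zero, so the logarithms are honest).

Reused, not restated: `soloX_supNorm_primPart_le`, `soloX_norm_aeval_primPart_le`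
(`SoloInformedX193Resultant`), `soloX_aeval_ne_zero` (`SoloInformedX193Budget`).
Unconditional apart from the hypothesis `Transcendental ℚ ξ` of (TW6); no sorries.  With
F9a (WF), F9b (Bud, S), F10 (PAIR, L1), F11b (FIN) this completes the laws; the assembly
`false_of_laws ↦ ¬ (Roy data of order 0)` is file F12.
-/

namespace Summit.Schanuel.Schanuel.Theorems

open Polynomial

/-! ### The twists of `soloX_pieces` -/

section twists

variable (ξ : ℂ) (R : ℕ → ℤ[X])

/-- For a piece `P` and `k, j ≥ 1` the twist IS the twist polynomial (no fallback). -/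
theorem soloX_pieces_twist_val' (P : soloX_pieceSet) {k j : ℕ} (hk : 1 ≤ k) (hj : 1 ≤ j) :
    ((soloX_pieces ξ R).twist P k j : ℤ[X]) = soloX_twistPoly (P : ℤ[X]) k j :=
  soloX_pieces_twist_val ξ R P k j (soloX_twistPoly_mem P hk hj)

/-- CHARACTERISATION: over `ℚ` the twist of `P` (column `k` to `j`) is associated to `P(kT/j)`;
together with `soloX_piece_eq_of_associated_map` this pins the twist down uniquely. -/
theorem soloX_pieces_twist_map_associated (P : soloX_pieceSet) {k j : ℕ} (hk : 1 ≤ k)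
    (hj : 1 ≤ j) :
    Associated ((((soloX_pieces ξ R).twist P k j : soloX_pieceSet) : ℤ[X]).map
        (Int.castRingHom ℚ))
      (((P : ℤ[X]).map (Int.castRingHom ℚ)).comp (C ((k : ℚ) / j) * X)) := by
  rw [soloX_pieces_twist_val' ξ R P hk hj]
  exact soloX_twistPoly_map_associated (soloX_piece_ne_zero P) (by omega) (by omega)

/-- (TW1) `twist P k k = P`. -/
theorem soloX_pieces_twist_self (P : soloX_pieceSet) {k : ℕ} (hk : 1 ≤ k) :
    (soloX_pieces ξ R).twist P k k = P := by
  apply soloX_piece_eq_of_associated_map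
  have h := soloX_pieces_twist_map_associated ξ R P hk hk
  rwa [div_self (show (k : ℚ) ≠ 0 by exact_mod_cast (show k ≠ 0 by omega)), C_1, one_mul,
    comp_X] at h

/-- (TW2) `twist (twist P k j) j j' = twist P k j'`. -/
theorem soloX_pieces_twist_twist (P : soloX_pieceSet) {k j j' : ℕ} (hk : 1 ≤ k) (hj : 1 ≤ j)
    (hj' : 1 ≤ j') :
    (soloX_pieces ξ R).twist ((soloX_pieces ξ R).twist P k j) j j' =
      (soloX_pieces ξ R).twist P k j' := by
  apply soloX_piece_eq_of_associated_map
  have h1 := soloX_pieces_twist_map_associated ξ R ((soloX_pieces ξ R).twist P k j) hj hj'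
  have h2 := soloX_associated_comp (soloX_pieces_twist_map_associated ξ R P hk hj)
    (C ((j : ℚ) / j') * X)
  rw [soloX_comp_C_mul_X_comp] at h2
  have h3 := soloX_pieces_twist_map_associated ξ R P hk hj'
  have e : (k : ℚ) / j * ((j : ℚ) / j') = (k : ℚ) / j' := by
    have : (j : ℚ) ≠ 0 := by exact_mod_cast (show j ≠ 0 by omega)
    have : (j' : ℚ) ≠ 0 := by exact_mod_cast (show j' ≠ 0 by omega)
    field_simp
  rw [e] at h2
  exact (h1.trans h2).trans h3.symm

/-- (TW3) `j ↦ twist P k j` is injective on `j ≥ 1`: over `ℚ`, `P(kT/j)` and `P(kT/j')` are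
unit multiples of each other only if `j = j'` (compare the constant and the leading
coefficients, `a_0 a_g ≠ 0`). -/
theorem soloX_pieces_twist_injective (P : soloX_pieceSet) {k j j' : ℕ} (hk : 1 ≤ k)
    (hj : 1 ≤ j) (hj' : 1 ≤ j') (hne : j ≠ j') :
    (soloX_pieces ξ R).twist P k j ≠ (soloX_pieces ξ R).twist P k j' := by
  intro heq
  have hk0 : (k : ℚ) ≠ 0 := by exact_mod_cast (show k ≠ 0 by omega)
  have hj0 : (j : ℚ) ≠ 0 := by exact_mod_cast (show j ≠ 0 by omega)
  have hj0' : (j' : ℚ) ≠ 0 := by exact_mod_cast (show j' ≠ 0 by omega)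
  have h1 := soloX_pieces_twist_map_associated ξ R P hk hj
  have h2 := soloX_pieces_twist_map_associated ξ R P hk hj'
  rw [heq] at h1
  obtain ⟨u, hu⟩ := h1.symm.trans h2
  obtain ⟨r, -, hru⟩ := Polynomial.isUnit_iff.mp u.isUnit
  have hc0 := congrArg (fun q : ℚ[X] => q.coeff 0) hu
  have hcg := congrArg (fun q : ℚ[X] => q.coeff (P : ℤ[X]).natDegree) hu
  simp only [← hru, coeff_mul_C, comp_C_mul_X_coeff, coeff_map, eq_intCast, pow_zero,
    mul_one] at hc0 hcg
  have ha0 : (((P : ℤ[X]).coeff 0 : ℤ) : ℚ) ≠ 0 := by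
    exact_mod_cast soloX_piece_coeff_zero_ne_zero P
  have hag : (((P : ℤ[X]).coeff (P : ℤ[X]).natDegree : ℤ) : ℚ) ≠ 0 := by
    rw [coeff_natDegree]; exact_mod_cast soloX_piece_leadingCoeff_ne_zero P
  have hr1 : r = 1 := by
    rcases mul_eq_mul_left_iff.mp (hc0.trans (mul_one _).symm) with h | h
    · exact h
    · exact absurd h ha0
  rw [hr1, mul_one] at hcg
  have hpow : ((k : ℚ) / j) ^ (P : ℤ[X]).natDegree = ((k : ℚ) / j') ^ (P : ℤ[X]).natDegree := by
    rcases mul_eq_mul_left_iff.mp hcg with h | h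
    · exact h
    · exact absurd h hag
  have hg : (P : ℤ[X]).natDegree ≠ 0 := by have := soloX_piece_natDegree_pos P; omega
  have hkj : (k : ℚ) / j = (k : ℚ) / j' :=
    (pow_left_inj₀ (by positivity) (by positivity) hg).mp hpow
  rw [div_eq_div_iff hj0 hj0'] at hkj
  have hjj : (j' : ℚ) = j := mul_left_cancel₀ hk0 hkj
  exact hne (by exact_mod_cast hjj.symm)

/-- (TW4) the twist has the degree of `P`. -/
theorem soloX_pieces_deg_twist (P : soloX_pieceSet) {k j : ℕ} (hk : 1 ≤ k) (hj : 1 ≤ j) :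
    (soloX_pieces ξ R).deg ((soloX_pieces ξ R).twist P k j) = (soloX_pieces ξ R).deg P := by
  rw [soloX_pieces_deg, soloX_pieces_deg, soloX_pieces_twist_val' ξ R P hk hj,
    soloX_natDegree_twistPoly _ (by omega)]

/-- (TW5) height of the twist: `log ‖twist P k j‖_∞ ≤ log ‖P‖_∞ + deg P · log max(k, j)`. -/
theorem soloX_pieces_logHt_twist_le (P : soloX_pieceSet) {k j : ℕ} (hk : 1 ≤ k) (hj : 1 ≤ j) :
    (soloX_pieces ξ R).logHt ((soloX_pieces ξ R).twist P k j) ≤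
      (soloX_pieces ξ R).logHt P + (soloX_pieces ξ R).deg P * Real.log (max k j : ℕ) := by
  rw [soloX_pieces_logHt, soloX_pieces_logHt, soloX_pieces_deg,
    soloX_pieces_twist_val' ξ R P hk hj, soloX_twistPoly_def, soloX_supNorm_normalize]
  have hD : soloX_dil (P : ℤ[X]) k j ≠ 0 := soloX_dil_ne_zero (soloX_piece_ne_zero P) (by omega) j
  have hm : (0 : ℝ) < ((max k j : ℕ) : ℝ) := by
    exact_mod_cast lt_of_lt_of_le (by omega : 0 < k) (le_max_left k j)
  have hP1 : (1 : ℝ) ≤ (P : ℤ[X]).supNorm := soloX_piece_one_le_supNorm P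
  have h1 : (soloX_dil (P : ℤ[X]) k j).primPart.supNorm ≤
      ((max k j : ℕ) : ℝ) ^ (P : ℤ[X]).natDegree * (P : ℤ[X]).supNorm :=
    (soloX_supNorm_primPart_le hD).trans (soloX_supNorm_dil_le _ hk hj)
  have h0 : (0 : ℝ) < (soloX_dil (P : ℤ[X]) k j).primPart.supNorm :=
    lt_of_lt_of_le one_pos (Polynomial.one_le_supNorm_of_ne_zero (primPart_ne_zero _))
  calc Real.log (soloX_dil (P : ℤ[X]) k j).primPart.supNorm
      ≤ Real.log (((max k j : ℕ) : ℝ) ^ (P : ℤ[X]).natDegree * (P : ℤ[X]).supNorm) :=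
        Real.log_le_log h0 h1
    _ = Real.log (P : ℤ[X]).supNorm +
          ((P : ℤ[X]).natDegree : ℝ) * Real.log ((max k j : ℕ) : ℝ) := by
        rw [Real.log_mul (pow_ne_zero _ hm.ne') (by linarith), Real.log_pow]; ring

/-- (TW6) bank transport: `bank P k - deg P · log max(k, j) ≤ bank (twist P k j) j`, i.e.
`‖twist P k j (jξ)‖ ≤ max(k, j)^g ‖P(kξ)‖` (from `dil P k j (jξ) = j^g P(kξ)` and
`‖primPart‖ ≤ ‖·‖` pointwise); `ξ` transcendental keeps both values non-zero. -/
theorem soloX_pieces_bank_twist_le {ξ : ℂ} (hξ : Transcendental ℚ ξ) (R : ℕ → ℤ[X])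
    (P : soloX_pieceSet) {k j : ℕ} (hk : 1 ≤ k) (hj : 1 ≤ j) :
    (soloX_pieces ξ R).bank P k - (soloX_pieces ξ R).deg P * Real.log (max k j : ℕ) ≤
      (soloX_pieces ξ R).bank ((soloX_pieces ξ R).twist P k j) j := by
  rw [soloX_pieces_bank, soloX_pieces_bank, soloX_pieces_deg,
    soloX_pieces_twist_val' ξ R P hk hj, soloX_twistPoly_def, soloX_norm_aeval_normalize]
  have hD : soloX_dil (P : ℤ[X]) k j ≠ 0 := soloX_dil_ne_zero (soloX_piece_ne_zero P) (by omega) j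
  have hT0 : aeval ((j : ℂ) * ξ) (soloX_dil (P : ℤ[X]) k j).primPart ≠ 0 :=
    soloX_aeval_ne_zero hξ hj (primPart_ne_zero _)
  have hPk : aeval ((k : ℂ) * ξ) (P : ℤ[X]) ≠ 0 :=
    soloX_aeval_ne_zero hξ hk (soloX_piece_ne_zero P)
  have hm : (0 : ℝ) < ((max k j : ℕ) : ℝ) := by
    exact_mod_cast lt_of_lt_of_le (by omega : 0 < k) (le_max_left k j)
  have hjm : (j : ℝ) ≤ ((max k j : ℕ) : ℝ) := by exact_mod_cast le_max_right k j
  have h1 : ‖aeval ((j : ℂ) * ξ) (soloX_dil (P : ℤ[X]) k j).primPart‖ ≤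
      ((max k j : ℕ) : ℝ) ^ (P : ℤ[X]).natDegree * ‖aeval ((k : ℂ) * ξ) (P : ℤ[X])‖ := by
    calc ‖aeval ((j : ℂ) * ξ) (soloX_dil (P : ℤ[X]) k j).primPart‖
        ≤ ‖aeval ((j : ℂ) * ξ) (soloX_dil (P : ℤ[X]) k j)‖ := soloX_norm_aeval_primPart_le hD _
      _ = (j : ℝ) ^ (P : ℤ[X]).natDegree * ‖aeval ((k : ℂ) * ξ) (P : ℤ[X])‖ := by
          rw [soloX_aeval_dil _ (by omega), norm_mul, norm_pow, Complex.norm_natCast]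
      _ ≤ ((max k j : ℕ) : ℝ) ^ (P : ℤ[X]).natDegree * ‖aeval ((k : ℂ) * ξ) (P : ℤ[X])‖ := by
          gcongr
  have h2 := Real.log_le_log (norm_pos_iff.mpr hT0) h1
  rw [Real.log_mul (pow_ne_zero _ hm.ne') (norm_ne_zero_iff.mpr hPk), Real.log_pow] at h2
  linarith

/-- **(TW)** `soloX_pieces ξ R ∈ twistLaw` for `ξ` transcendental. -/
theorem soloX_pieces_twistLaw {ξ : ℂ} (hξ : Transcendental ℚ ξ) (R : ℕ → ℤ[X]) :
    soloX_pieces ξ R ∈ SoloServiceData.twistLaw := by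
  intro P k j j' hk hj hj'
  exact ⟨soloX_pieces_twist_self ξ R P hk, soloX_pieces_twist_twist ξ R P hk hj hj',
    soloX_pieces_twist_injective ξ R P hk hj hj', soloX_pieces_deg_twist ξ R P hk hj,
    soloX_pieces_logHt_twist_le ξ R P hk hj, soloX_pieces_bank_twist_le hξ R P hk hj⟩

end twists

end Summit.Schanuel.Schanuel.Theorems
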